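/-
Copyright (c) 2026 the pub-hodgecm-mathlib formalisation cell (harness21).  Prover seat hodgecm-mathlib-K2E1-p16 (g4), Track B ∕ K2-LIT, h413 = `stmt-HodgeConjecture-24833`,
R90-TF section S8 «ContSpec-n½», socket (E) :276 (N₃) row, S8 dealer R90-CS-plan (g3) LAST DEAL S8-R252 («E1 estate REMAINDER: census `hUΛ hline hC hPdef`, file the payable ones»;
census `R90/S8/CENSUS-EstateRemainderOfTauModel.K2E1-p16-g4.md`): the ONE payable remainder — the BLOCK-PROJECTOR ESTATE of a τ-cut block, LETTER-FREE (`χK e`, the χ_τ♮-formula,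
`hχconv hχinv he0 he1 heK hestar`, and for `P := R_K(χK) ∘L R_f(e)` — `hPdef := rfl` — the three projector rows `hPV hPsa hPW` D5′ consumes), for ANY unitary strongly continuous
representation of `U(J₃)(𝔸_{L⁺})`.  (L2) `hUΛ`, (L3) `hline`, (C) `hC` are NOT τ-model letters (the E1-Plancherel body; census items 2–3) and are not claimed.
-/
import Summits.HodgeConjecture.HodgeConjecture.Theorems.R90S8ResGBlockCharacterEstateOfTauModelU3   -- ★ p865000 (this seat): `exists_characterEstate_of_tau`; brings ★ p864952 FILE A (`cm_blockProjector_hPV_of_conv`), ★ `K2E1HeckeAlgebraLettersCM` (`cm_blockProjector_hPsa ∕ _hPW`)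
import HarnessLib

/-!
# R90-TF · S8 «ContSpec-n½» — `R90S8ResGBlockEstateRemainderOfTauModelU3`: THE BLOCK-PROJECTOR ESTATE OF A τ-CUT BLOCK, LETTER-FREE (`χK e hχconv hχinv he0 he1 heK hestar` + `hPV hPsa hPW`
# for `P := R_K(χ_τ♮) ∘L R_f(e_{K_f})`, any unitary strongly continuous `π` of `U(J₃)(𝔸_{L⁺})`)

Cell `hodgecm-mathlib`, crux H413 (`stmt-HodgeConjecture-24833`, lane `--supports … --as helper`), route of record `HCCMUnconditional`; R90-TF section S8, socket (E) `sock_S8_res_exhaustion_le_closure`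
(B ED. 7 :276), (N₃) row per `K_∞`-type (K-TYPE CURRENCY FLAG S8-R189; ★ F0P2-p10 `hNblk_of_tauCuts` glue).  THEOREMS ONLY (no `def`, no `instance`, no `notation`, no named-fact hypothesis, no
`sorry`; default heartbeats); count-neutral; CLOSES NO SOCKET; pays no letter beyond the ones it inhabits.

WHAT IS PAID AND WHAT IS NOT (census S8-R252, honest).  The bill of ★ `hNblk_of_record_of_conv` (FILE C p865020) at a τ-cut block reads: D5′ data `(νinf, νf, κ, μK, χ, e, m)`, character estate
`hχconv hχinv he0 he1 heK hestar`, block projector `P hPdef`, (L1) `T hT𝓐 hTP hTB`, (L2) `UΛ s hs hUΛ`, (L3) `hline`, `hScP`, (C) `hC`.  FROM THE τ-MODEL the following are PAYABLE and are paid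
here in ONE `obtain`: the kernels `χ := χ_τ♮ = dim τ • conj χ_τ` and `e := ν_f(K_f)⁻¹ 𝟙_{K_f}` with their six letters (★ `exists_characterEstate_of_tau`), and — for the block projector
`P := R_K(χ) ∘L R_f(e)` (so `hPdef := rfl` at the consumer) — the three rows the abstract D5′ (★ p860349 `indicator_lpSMul_proj_eq_zero_of_irreducible_subrep`) consumes: **`hPV`** `P x ∈ Fix(P)`
(★ FILE A `cm_blockProjector_hPV_of_conv` — convolution idempotence, the χ_τ point), **`hPsa`** `⟪P x, y⟫ = ⟪x, P y⟫` (★ `cm_blockProjector_hPsa` — `hχinv`, `hestar`), **`hPW`** `P(W) ⊆ W` for every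
closed `π`-stable `W` (★ `cm_blockProjector_hPW`).  NOT PAYABLE from the τ-model and NOT claimed: (L2) the Plancherel coordinate `UΛ` of the τ-cut block with its Hecke multipliers `hUΛ` and
(C) its completeness `hC` — the E1-PLANCHEREL BODY ([MoeglinWaldspurger1995] II.2.1, XL, unowned) —, and (L3) `hline`, a property of the (L2) symbol family whose generic engine is ★
`K2E1AnalyticLevelSetNullU` (one non-constant analytic symbol on the unitary axis suffices), payable only once (L1)∕(L2) fix `(Ω, m, s_j)`.
* **`exists_blockProjectorEstate_of_tau`** — at `U(J₃)_{L∕L⁺}` (`cmDatum L 3 ((StdForm.antidiagonal 3).over L)`), the index of record `Kf` (open, `≤ K₀`), any compact second-countable `K →* U(J₃)(L⁺ ⊗ ℝ)`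
  with a two-sided-ready probability Haar `μK` (left- and inversion-invariant), any irreducible unitary continuous finite-dimensional `τ`, any `ν_f` finite on compacta, positive on opens, left- and
  inversion-invariant, ANY unitary strongly continuous `π` on a Hilbert space: `∃ χ e, [formula ∧ hχconv ∧ hχinv] ∧ [he0 ∧ he1 ∧ heK ∧ hestar] ∧ [hPV ∧ hPsa ∧ hPW]`.
HONEST LABEL: HC_CM is proved only modulo the 7 printed citations (2 remaining named inputs: hLiu418 = `stmt-HodgeConjecture-24832`, h413 = `stmt-HodgeConjecture-24833`) until rung 0
closes; REL ≠ ★ ≠ BUILT; (L1)(L2)(L3)(C) and `hScP` of the τ-cut block remain the visible bill (`hScP` is ★ F0P2-p10 `hScP_tauCut_of_record`); this file asserts no named fact and closes no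
socket; count-neutral; unconditional.

## References
* [MoeglinWaldspurger1995] C. Mœglin, J.-L. Waldspurger, *Spectral Decomposition and Eisenstein Series* (1995), II.2.1, IV.3.12 (b), VI.2.
* [BrockerTomDieck1985] T. Bröcker, T. tom Dieck, *Representations of Compact Lie Groups*, GTM 98 (1985), II (4.16), III (5.10).
* [DeitmarEchterhoff2014] A. Deitmar, S. Echterhoff, *Principles of Harmonic Analysis* (2nd ed., 2014), Prop. 6.2.1, §7.4, §9.2.
* [BorelJacquet1979] A. Borel, H. Jacquet, *Automorphic forms and automorphic representations*, PSPM 33.1 (1979), §4.1.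
-/

set_option autoImplicit false
set_option linter.dupNamespace false  -- the mandated namespace `…HodgeConjecture.HodgeConjecture.R90.S8` (LEAD #1 L1) repeats the summit's segment

noncomputable section

open MeasureTheory Filter Topology CompactlySupported NumberField ContRepresentation Set
open scoped InnerProductSpace ENNReal ComplexConjugate
open Literature.NumberTheory.Automorphic Literature.NumberTheory.Automorphic.UnitaryGroup AdelicGroupData
open Literature.RepresentationTheory.CompactGroups
open Summit.HodgeConjecture.HodgeConjecture.Cruxes.H413.K2E1HeckeAlgebraLettersCM

namespace Summit.HodgeConjecture.HodgeConjecture.R90.S8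

/-- **THE BLOCK-PROJECTOR ESTATE OF A τ-CUT BLOCK, LETTER-FREE** (S8-R252 remainder census, item 1): at `U(J₃)_{L∕L⁺}`, the index of record `Kf`, a compact second-countable `K →* U(J₃)(L⁺ ⊗ ℝ)` with
a left- and inversion-invariant probability measure `μK`, an irreducible unitary continuous finite-dimensional `K`-type `τ`, a measure `ν_f` on `U(J₃)(𝔸_{L⁺,f})` finite on compacta, positive
on opens, left- and inversion-invariant, and ANY unitary strongly continuous `π`: there are kernels `χ` (the χ_τ-idempotent, `χ k = dim τ * conj χ_τ(k)`) and `e` (the level idempotent of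
`Kf`) carrying the character-estate letters `hχconv hχinv he0 he1 heK hestar` (★ `exists_characterEstate_of_tau`) such that the block projector `P := R_K(χ) ∘L R_f(e)` satisfies the three
D5′ rows `hPV` (★ `cm_blockProjector_hPV_of_conv`), `hPsa` (★ `cm_blockProjector_hPsa`), `hPW` (★ `cm_blockProjector_hPW`).  The consumer sets `hPdef := rfl`.
[cite: BrockerTomDieck1985, II Prop (4.16)] [cite: DeitmarEchterhoff2014, Prop. 6.2.1] [cite: BorelJacquet1979, §4.1] [cite: MoeglinWaldspurger1995, IV.3.12, VI.2] -/
theorem exists_blockProjectorEstate_of_tau (L : Type) [Field L] [NumberField L] [IsCMField L]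
    [MeasurableSpace (finAdelic (↥(maximalRealSubfield L)) L (IsCMField.complexConj L) 3 ((StdForm.antidiagonal 3).over L))] [BorelSpace (finAdelic (↥(maximalRealSubfield L)) L (IsCMField.complexConj L) 3 ((StdForm.antidiagonal 3).over L))]
    (νf : Measure (finAdelic (↥(maximalRealSubfield L)) L (IsCMField.complexConj L) 3 ((StdForm.antidiagonal 3).over L))) [IsFiniteMeasureOnCompacts νf] [νf.IsOpenPosMeasure] [νf.IsMulLeftInvariant]
    [νf.IsInvInvariant]
    (Kf : {Kf : Subgroup ↥(finAdelic (↥(maximalRealSubfield L)) L (IsCMField.complexConj L) 3 ((StdForm.antidiagonal 3).over L)) // IsOpen ((Kf : Subgroup ↥(finAdelic (↥(maximalRealSubfield L)) L (IsCMField.complexConj L) 3 ((StdForm.antidiagonal 3).over L))) : Set ↥(finAdelic (↥(maximalRealSubfield L)) L (IsCMField.complexConj L) 3 ((StdForm.antidiagonal 3).over L))) ∧ Kf ≤ ((((standardMaximalCompactGL 3 L).comap (adelicVal (↥(maximalRealSubfield L)) L (IsCMField.complexConj L) 3 ((StdForm.antidiagonal 3).over L)) : Subgroup (quasiSplit (↥(maximalRealSubfield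 L)) L (IsCMField.complexConj L) 3).Adelic)).comap (finAdelicToAdelic (↥(maximalRealSubfield L)) L (IsCMField.complexConj L) 3 ((StdForm.antidiagonal 3).over L)) : Subgroup ↥(finAdelic (↥(maximalRealSubfield L)) L (IsCMField.complexConj L) 3 ((StdForm.antidiagonal 3).over L)))})
    {K : Type*} [Group K] [TopologicalSpace K] [IsTopologicalGroup K] [MeasurableSpace K] [BorelSpace K] [CompactSpace K] [SecondCountableTopology K]
    (κ : K →* UnitaryGroup.arch (↥(maximalRealSubfield L)) L (IsCMField.complexConj L) 3 ((StdForm.antidiagonal 3).over L)) (hκ : Continuous κ)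
    (μK : Measure K) [IsFiniteMeasureOnCompacts μK] [IsProbabilityMeasure μK] [μK.IsMulLeftInvariant] [μK.IsInvInvariant]
    {E : Type*} [NormedAddCommGroup E] [InnerProductSpace ℂ E] [FiniteDimensional ℂ E] (τ : ContRepresentation ℂ K E) (hτc : Continuous (τ : K → E →L[ℂ] E))
    [τ.toRepresentation.IsIrreducible] (hτu : ∀ (k : K) (v w : E), ⟪τ k v, τ k w⟫_ℂ = ⟪v, w⟫_ℂ)
    {V : Type*} [NormedAddCommGroup V] [InnerProductSpace ℂ V] [CompleteSpace V]
    (π : ContRepresentation ℂ (cmDatum L 3 ((StdForm.antidiagonal 3).over L)).Adelic V) (hu : π.IsUnitary) (hc : π.IsStronglyContinuous) :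
    ∃ (χ : C_c(K, ℂ)) (e : C_c(finAdelic (↥(maximalRealSubfield L)) L (IsCMField.complexConj L) 3 ((StdForm.antidiagonal 3).over L), ℂ)),
      ((∀ k, χ k = (Module.finrank ℂ E : ℂ) * conj (Schur.character τ k)) ∧ (∀ x, χ x = mulConv μK (⇑χ) (⇑χ) x) ∧ (∀ k, conj (χ k⁻¹) = χ k)) ∧
      ((∀ x : finAdelic (↥(maximalRealSubfield L)) L (IsCMField.complexConj L) 3 ((StdForm.antidiagonal 3).over L), x ∉ Kf.1 → e x = 0) ∧ ∫ x, e x ∂νf = 1 ∧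
        (∀ k ∈ Kf.1, ∀ x, e (k * x) = e x) ∧ ∀ x : finAdelic (↥(maximalRealSubfield L)) L (IsCMField.complexConj L) 3 ((StdForm.antidiagonal 3).over L), mulStar (⇑e) x = e x) ∧
      (∀ x : V, ((π.restrict ((archToAdelic (↥(maximalRealSubfield L)) L (IsCMField.complexConj L) 3 ((StdForm.antidiagonal 3).over L)).comp κ)).integratedOperator (hu.restrict _)
            (hc.restrict _ ((continuous_archToAdelic (↥(maximalRealSubfield L)) L (IsCMField.complexConj L) 3 ((StdForm.antidiagonal 3).over L)).comp hκ)) μK χ ∘L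
          (π.restrict (finAdelicToAdelic (↥(maximalRealSubfield L)) L (IsCMField.complexConj L) 3 ((StdForm.antidiagonal 3).over L))).integratedOperator (hu.restrict _)
            (hc.restrict _ (continuous_finAdelicToAdelic (↥(maximalRealSubfield L)) L (IsCMField.complexConj L) 3 ((StdForm.antidiagonal 3).over L))) νf e) x ∈
        LinearMap.eqLocus (((π.restrict ((archToAdelic (↥(maximalRealSubfield L)) L (IsCMField.complexConj L) 3 ((StdForm.antidiagonal 3).over L)).comp κ)).integratedOperator (hu.restrict _)
            (hc.restrict _ ((continuous_archToAdelic (↥(maximalRealSubfield L)) L (IsCMField.complexConj L) 3 ((StdForm.antidiagonal 3).over L)).comp hκ)) μK χ ∘L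
          (π.restrict (finAdelicToAdelic (↥(maximalRealSubfield L)) L (IsCMField.complexConj L) 3 ((StdForm.antidiagonal 3).over L))).integratedOperator (hu.restrict _)
            (hc.restrict _ (continuous_finAdelicToAdelic (↥(maximalRealSubfield L)) L (IsCMField.complexConj L) 3 ((StdForm.antidiagonal 3).over L))) νf e : V →L[ℂ] V) : V →ₗ[ℂ] V) LinearMap.id) ∧
      (∀ x y : V, ⟪((π.restrict ((archToAdelic (↥(maximalRealSubfield L)) L (IsCMField.complexConj L) 3 ((StdForm.antidiagonal 3).over L)).comp κ)).integratedOperator (hu.restrict _)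
            (hc.restrict _ ((continuous_archToAdelic (↥(maximalRealSubfield L)) L (IsCMField.complexConj L) 3 ((StdForm.antidiagonal 3).over L)).comp hκ)) μK χ ∘L
          (π.restrict (finAdelicToAdelic (↥(maximalRealSubfield L)) L (IsCMField.complexConj L) 3 ((StdForm.antidiagonal 3).over L))).integratedOperator (hu.restrict _)
            (hc.restrict _ (continuous_finAdelicToAdelic (↥(maximalRealSubfield L)) L (IsCMField.complexConj L) 3 ((StdForm.antidiagonal 3).over L))) νf e) x, y⟫_ℂ =
        ⟪x, ((π.restrict ((archToAdelic (↥(maximalRealSubfield L)) L (IsCMField.complexConj L) 3 ((StdForm.antidiagonal 3).over L)).comp κ)).integratedOperator (hu.restrict _)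
            (hc.restrict _ ((continuous_archToAdelic (↥(maximalRealSubfield L)) L (IsCMField.complexConj L) 3 ((StdForm.antidiagonal 3).over L)).comp hκ)) μK χ ∘L
          (π.restrict (finAdelicToAdelic (↥(maximalRealSubfield L)) L (IsCMField.complexConj L) 3 ((StdForm.antidiagonal 3).over L))).integratedOperator (hu.restrict _)
            (hc.restrict _ (continuous_finAdelicToAdelic (↥(maximalRealSubfield L)) L (IsCMField.complexConj L) 3 ((StdForm.antidiagonal 3).over L))) νf e) y⟫_ℂ) ∧
      ∀ (W : ClosedSubrep π), ∀ w ∈ W, ((π.restrict ((archToAdelic (↥(maximalRealSubfield L)) L (IsCMField.complexConj L) 3 ((StdForm.antidiagonal 3).over L)).comp κ)).integratedOperator (hu.restrict _)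
            (hc.restrict _ ((continuous_archToAdelic (↥(maximalRealSubfield L)) L (IsCMField.complexConj L) 3 ((StdForm.antidiagonal 3).over L)).comp hκ)) μK χ ∘L
          (π.restrict (finAdelicToAdelic (↥(maximalRealSubfield L)) L (IsCMField.complexConj L) 3 ((StdForm.antidiagonal 3).over L))).integratedOperator (hu.restrict _)
            (hc.restrict _ (continuous_finAdelicToAdelic (↥(maximalRealSubfield L)) L (IsCMField.complexConj L) 3 ((StdForm.antidiagonal 3).over L))) νf e) w ∈ W := by
  obtain ⟨χ, e, hχτ, hχconv, hχinv, he0, he1, heK, hestar⟩ := exists_characterEstate_of_tau L νf Kf μK τ hτc hτu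
  exact ⟨χ, e, ⟨hχτ, hχconv, hχinv⟩, ⟨he0, he1, heK, hestar⟩,
    fun x => cm_blockProjector_hPV_of_conv π hu hc νf κ hκ μK χ e hχconv Kf.1 he0 he1 heK x,
    fun x y => cm_blockProjector_hPsa π hu hc νf κ hκ μK χ e hχinv hestar x y,
    fun W w hw => cm_blockProjector_hPW π hu hc νf κ hκ μK χ e W w hw⟩

end Summit.HodgeConjecture.HodgeConjecture.R90.S8

end
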